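import Literature.MathematicalPhysics.StatisticalMechanics.BarlowStacking
import Literature.MathematicalPhysics.StatisticalMechanics.Crystallization
import Summits.AtomisticToContinuum.Crystallization.Theorems.NashClassCertificatesNashNearFieldStubSmoothRegimeCoercivityWords

/-!
# Crux `PricedLinkCensus.TruncatedCensusGap` (stmt-AtomisticToContinuum-14230), line `near-far-split`,
# stub N2 `stub_harmonicCoercivityWindow`: reduction to PERIODIC Hägg words

The stub N2 asks for one `κ > 0` such that for EVERY Hägg word `s`, every cell `(a, h)` of the
near-window (`93/100 ≤ a ≤ 51/50`, `78a/100 ≤ h ≤ 86a/100`) and every finitely supported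
displacement field `u` of the Barlow stacking `barlowStacking a h s`, the `V_χ` pair-Hessian form
`½ ∑_{p ≠ q} hessV (p - q) (u p - u q)` dominates `κ ×` the nearest-neighbour difference form
`∑_{dist p q ≤ 11a/10} ‖u p - u q‖²`.  This file proves that it is enough to establish the inequality
(with the same `κ`) for PERIODIC Hägg words (`harmonicCoercivityWindow_of_periodic`,
`harmonicCoercivityWindow_of_periodic'`), for which the best constant is a Bloch (band) minimum.

The argument is bookkeeping:

* both double sums only involve pairs `(p, q)` with `u p ≠ 0` or `u q ≠ 0` (the summands vanish at
  `u p = u q = 0`: `‖0 - 0‖² = 0`, `hessV e 0 = 0`) and with `dist p q ≤ 2` (`11a/10 < 2`; the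
  kernels `kRad`, `kTan` vanish from `2` on), and layers of the stacking at layer distance `≥ 3` are
  `≥ 3h > 2` apart (`3h ≥ 3 · 0.78 · 0.93 > 2`); so if the support of `u` lies in the slab
  `|x₃| ≤ (K - 3) h`, both sides only see the stacking inside the slab `|x₃| ≤ K h`, i.e. the layers
  `-K ≤ k ≤ K` (`tsum_tsum_barlowStacking_eq_of_agree`, from the abstract
  `tsum_tsum_subtype_congr_of_vanish`);
* those layers are determined by the letters `s i`, `-K ≤ i < K` (`stub_barlowPos_eq_of_agree`), and
  every Hägg word agrees on `[-K, K]` with a `(2K+1)`-periodic Hägg word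
  (`stub_existsPeriodicHaggAgree`, both from
  `NashClassCertificatesNashNearFieldStubSmoothRegimeCoercivityWords`).

No lateral translation is needed: the periodisation window is centred at layer `0` and `K` is taken
large enough to contain the support.  All `[folklore]`.
-/

noncomputable section

namespace Summit.AtomisticToContinuum.Crystallization.Theorems.PricedLinkCensusTruncatedCensusGap

open scoped BigOperators
open Literature.MathematicalPhysics.StatisticalMechanics
open Summit.AtomisticToContinuum.Crystallization.Theorems.NashClassCertificatesNashNearField
  (stub_barlowPos_eq_of_agree stub_existsPeriodicHaggAgree)

/-! ## Sums over two index sets that agree wherever the summand lives -/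

section TsumCongr

variable {β α : Type*} [AddCommMonoid α] [TopologicalSpace α]

/-- Two `tsum`s over subtypes `S`, `S'` agree if the summands agree on `S ∩ S'` and vanish on the
symmetric difference. [folklore] -/
theorem tsum_subtype_congr_of_vanish {S S' : Set β} (G G' : β → α)
    (hGG' : ∀ p, p ∈ S → p ∈ S' → G p = G' p) (hG : ∀ p, p ∈ S → p ∉ S' → G p = 0)
    (hG' : ∀ p, p ∈ S' → p ∉ S → G' p = 0) :
    ∑' p : S, G p = ∑' p : S', G' p := by
  rw [tsum_subtype S G, tsum_subtype S' G']
  refine tsum_congr fun p => ?_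
  by_cases hp : p ∈ S <;> by_cases hp' : p ∈ S'
  · rw [Set.indicator_of_mem hp, Set.indicator_of_mem hp', hGG' p hp hp']
  · rw [Set.indicator_of_mem hp, Set.indicator_of_notMem hp', hG p hp hp']
  · rw [Set.indicator_of_notMem hp, Set.indicator_of_mem hp', hG' p hp' hp]
  · rw [Set.indicator_of_notMem hp, Set.indicator_of_notMem hp']

/-- **Double sums over two index sets agree** when the summand `F p q` vanishes as soon as one of
`p`, `q` (both taken in `S ∪ S'`) lies outside `S ∩ S'`. [folklore] -/
theorem tsum_tsum_subtype_congr_of_vanish {S S' : Set β} (F : β → β → α)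
    (hF : ∀ p q, p ∈ S ∪ S' → q ∈ S ∪ S' → (p ∉ S ∩ S' ∨ q ∉ S ∩ S') → F p q = 0) :
    ∑' p : S, ∑' q : S, F p q = ∑' p : S', ∑' q : S', F p q := by
  refine tsum_subtype_congr_of_vanish (fun p => ∑' q : S, F p q) (fun p => ∑' q : S', F p q)
    (fun p hp hp' => ?_) (fun p hp hp' => ?_) (fun p hp' hp => ?_)
  · refine tsum_subtype_congr_of_vanish (F p) (F p) (fun q _ _ => rfl) (fun q hq hq' => ?_)
      (fun q hq' hq => ?_)
    · exact hF p q (Or.inl hp) (Or.inl hq) (Or.inr fun h => hq' h.2)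
    · exact hF p q (Or.inl hp) (Or.inr hq') (Or.inr fun h => hq h.1)
  · have h0 : ∀ q : S, F p q = 0 := fun q =>
      hF p q (Or.inl hp) (Or.inl q.2) (Or.inl fun h => hp' h.2)
    simp [h0]
  · have h0 : ∀ q : S', F p q = 0 := fun q =>
      hF p q (Or.inr hp') (Or.inr q.2) (Or.inl fun h => hp h.1)
    simp [h0]

end TsumCongr

/-! ## Locality of the two double sums in the layers of the stacking -/

section Window

variable {a h : ℝ} {s s' : ℤ → ℤ}

/-- If two words agree on the letters `-K ≤ i < K`, a point of the first stacking in the slab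
`|x₃| ≤ K h` (`0 < h`) is a point of the second stacking. [folklore] -/
theorem mem_barlowStacking_of_agree (hh : 0 < h) {K : ℕ}
    (hag : ∀ i : ℤ, -(K : ℤ) ≤ i → i < K → s' i = s i) {x : EuclideanSpace ℝ (Fin 3)}
    (hx : x ∈ barlowStacking a h s) (hxK : |x 2| ≤ K * h) :
    x ∈ barlowStacking a h s' := by
  obtain ⟨k, i, j, rfl⟩ := hx
  rw [barlowPos_apply_two, abs_mul, abs_of_pos hh] at hxK
  have hk : |(k : ℝ)| ≤ K := le_of_mul_le_mul_right hxK hh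
  have hk' : |k| ≤ (K : ℤ) := by
    rw [← Int.cast_abs] at hk
    exact_mod_cast hk
  obtain ⟨hk₁, hk₂⟩ := abs_le.1 hk'
  exact ⟨k, i, j, (stub_barlowPos_eq_of_agree a h s s' K hag k i j hk₁ hk₂).symm⟩

/-- **Locality of double sums over a Barlow stacking.**  Let the words `s`, `s'` agree on the
letters `-K ≤ i < K` (`0 < h`), and let `F p q` vanish unless one of `p`, `q` lies in a set `U`
inside the slab `|x₃| ≤ (K - 3) h`, and vanish for `dist p q > 3h`.  Then the double sums of `F`
over the two stackings `barlowStacking a h s`, `barlowStacking a h s'` agree. [folklore] -/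
theorem tsum_tsum_barlowStacking_eq_of_agree (hh : 0 < h) {K : ℕ}
    (hag : ∀ i : ℤ, -(K : ℤ) ≤ i → i < K → s' i = s i) {U : Set (EuclideanSpace ℝ (Fin 3))}
    (hU : ∀ x ∈ U, |x 2| ≤ ((K : ℝ) - 3) * h)
    (F : EuclideanSpace ℝ (Fin 3) → EuclideanSpace ℝ (Fin 3) → ℝ)
    (hFU : ∀ p q, p ∉ U → q ∉ U → F p q = 0) (hFR : ∀ p q, 3 * h < dist p q → F p q = 0) :
    ∑' p : barlowStacking a h s, ∑' q : barlowStacking a h s, F p q =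
      ∑' p : barlowStacking a h s', ∑' q : barlowStacking a h s', F p q := by
  set S := barlowStacking a h s with hS
  set S' := barlowStacking a h s' with hS'
  have hag' : ∀ i : ℤ, -(K : ℤ) ≤ i → i < K → s i = s' i := fun i h1 h2 => (hag i h1 h2).symm
  -- points of `S ∪ S'` in the slab `|x₃| ≤ K h` are common to both stackings
  have hslab : ∀ p : EuclideanSpace ℝ (Fin 3), p ∈ S ∪ S' → |p 2| ≤ K * h →
      p ∈ S ∩ S' := by
    rintro p (hp | hp) hpK
    · exact ⟨hp, mem_barlowStacking_of_agree hh hag hp hpK⟩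
    · exact ⟨mem_barlowStacking_of_agree hh hag' hp hpK, hp⟩
  -- hence a point of `S ∪ S'` outside `S ∩ S'` is `> 3h` away from `U` (and not in `U`)
  have hfar : ∀ p q : EuclideanSpace ℝ (Fin 3), p ∈ S ∪ S' → p ∉ S ∩ S' → q ∈ U →
      3 * h < dist p q := by
    intro p q hp hp' hq
    have hpK : (K : ℝ) * h < |p 2| := by
      by_contra hcon
      exact hp' (hslab p hp (not_lt.1 hcon))
    have hqK := hU q hq
    have h2 : |p 2| - |q 2| ≤ dist p q :=
      (abs_sub_abs_le_abs_sub _ _).trans (by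
        simpa [Real.dist_eq] using PiLp.dist_apply_le p q 2)
    nlinarith
  have hout : ∀ p : EuclideanSpace ℝ (Fin 3), p ∈ S ∪ S' → p ∉ S ∩ S' → p ∉ U := by
    intro p hp hp' hpU
    have := hfar p p hp hp' hpU
    rw [dist_self] at this
    linarith
  refine tsum_tsum_subtype_congr_of_vanish F fun p q hp hq hpq => ?_
  rcases hpq with hp' | hq'
  · by_cases hqU : q ∈ U
    · exact hFR p q (hfar p q hp hp' hqU)
    · exact hFU p q (hout p hp hp') hqU
  · by_cases hpU : p ∈ U
    · refine hFR p q ?_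
      rw [dist_comm]
      exact hfar q p hq hq' hpU
    · exact hFU p q hpU (hout q hq hq')

end Window

/-! ## The reduction -/

/-- **N2 reduces to periodic words (kernel-abstract form).**  For ANY pair-Hessian kernel `hessV`
with `hessV e 0 = 0` and `hessV e w = 0` for `‖e‖ ≥ 2` (finite range `2`): if the coercivity
inequality of `stub_harmonicCoercivityWindow` holds with constant `κ` for every PERIODIC Hägg word
on the near-window, then it holds with the same `κ` for every Hägg word.  The finitely supported
field `u` lives in finitely many layers, both double sums only see the layers within `2 < 3h` of
them, and those layers are shared with the stacking of a periodic word agreeing with `s` on a large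
enough window (`stub_existsPeriodicHaggAgree`, `stub_barlowPos_eq_of_agree`). [folklore] -/
theorem harmonicCoercivityWindow_of_periodic :
    ∀ hessV : EuclideanSpace ℝ (Fin 3) → EuclideanSpace ℝ (Fin 3) → ℝ, (∀ e : EuclideanSpace ℝ (Fin 3), hessV e 0 = 0) → (∀ e w : EuclideanSpace ℝ (Fin 3), 2 ≤ ‖e‖ → hessV e w = 0) → ∀ κ : ℝ, (∀ (s : ℤ → ℤ) (p : ℕ), p ≠ 0 → (∀ i : ℤ, s (i + p) = s i) → Literature.MathematicalPhysics.StatisticalMechanics.IsHaggSeq s → ∀ a h : ℝ, 93 / 100 ≤ a → a ≤ 51 / 50 → 78 / 100 * a ≤ h → h ≤ 86 / 100 * a → ∀ u : EuclideanSpace ℝ (Fin 3) → EuclideanSpace ℝ (Fin 3), (Function.support u).Finite → Function.support u ⊆ Literature.MathematicalPhysics.StatisticalMechanics.barlowStacking a h s → κ * (∑' p : Literature.MathematicalPhysics.StatisticalMechanics.barlowStacking a h s, ∑' q : Literature.MathematicalPhysics.StatisticalMechanics.barlowStacking a h s, if dist (p : EuclideanSpace ℝ (Fin 3)) q ≤ 11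 / 10 * a then ‖u p - u q‖ ^ 2 else 0) ≤ (∑' p : Literature.MathematicalPhysics.StatisticalMechanics.barlowStacking a h s, ∑' q : Literature.MathematicalPhysics.StatisticalMechanics.barlowStacking a h s, if (p : EuclideanSpace ℝ (Fin 3)) ≠ q then hessV ((p : EuclideanSpace ℝ (Fin 3)) - q) (u p - u q) else 0) / 2) → ∀ s : ℤ → ℤ, Literature.MathematicalPhysics.StatisticalMechanics.IsHaggSeq s → ∀ a h : ℝ, 93 / 100 ≤ a → a ≤ 51 / 50 → 78 / 100 * a ≤ h → h ≤ 86 / 100 * a → ∀ u : EuclideanSpace ℝ (Fin 3) → EuclideanSpace ℝ (Fin 3), (Function.support u).Finite → Function.support u ⊆ Literature.MathematicalPhysics.StatisticalMechanics.barlowStacking a h s → κ * (∑' p : Literature.MathematicalPhysics.StatisticalMechanics.barlowStacking a h s, ∑' q : Literature.MathematicalPhysics.StatisticalMechanics.barlowStacking a h s, if dist (p : EuclideanSpace ℝ (Fin 3)) q ≤ 11 / 10 * a then ‖u p - u q‖ ^ 2 else 0) ≤ (∑' p : Literature.MathematicalPhysics.StatisticalMechanics.barlowStacking a h s, ∑'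 q : Literature.MathematicalPhysics.StatisticalMechanics.barlowStacking a h s, if (p : EuclideanSpace ℝ (Fin 3)) ≠ q then hessV ((p : EuclideanSpace ℝ (Fin 3)) - q) (u p - u q) else 0) / 2 := by
  intro hessV F1 F2 κ hper s hs a h ha1 ha2 hh1 hh2 u hfin hsub
  have hh : 0 < h := by linarith
  -- a slab containing the support
  obtain ⟨B, hB⟩ := (hfin.image fun x : EuclideanSpace ℝ (Fin 3) => |x 2|).bddAbove
  have hB' : ∀ x ∈ Function.support u, |x 2| ≤ B := fun x hx => hB ⟨x, hx, rfl⟩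
  obtain ⟨K₀, hK₀⟩ := exists_nat_ge (B / h)
  have hBK : B ≤ (K₀ : ℝ) * h := by rwa [div_le_iff₀ hh] at hK₀
  set K : ℕ := K₀ + 3 with hK
  have hU : ∀ x ∈ Function.support u, |x 2| ≤ ((K : ℝ) - 3) * h := by
    intro x hx
    have : ((K : ℝ) - 3) = K₀ := by rw [hK]; push_cast; ring
    rw [this]
    exact (hB' x hx).trans hBK
  -- a periodic word agreeing with `s` on `[-K, K]`
  obtain ⟨s', p, hp, hs', hper', hag⟩ := stub_existsPeriodicHaggAgree s K hs
  have hag' : ∀ i : ℤ, -(K : ℤ) ≤ i → i < K → s' i = s i := fun i h1 h2 => hag i h1 h2.le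
  -- the support lies in the periodic stacking too
  have hsub' : Function.support u ⊆ barlowStacking a h s' := by
    intro x hx
    refine mem_barlowStacking_of_agree hh hag' (hsub hx) ((hU x hx).trans ?_)
    nlinarith
  have key := hper s' p hp hper' hs' a h ha1 ha2 hh1 hh2 u hfin hsub'
  -- both double sums agree for `s` and `s'`
  have eL : (∑' p : barlowStacking a h s, ∑' q : barlowStacking a h s,
      (if dist (p : EuclideanSpace ℝ (Fin 3)) q ≤ 11 / 10 * a then ‖u p - u q‖ ^ 2 else 0)) =
      ∑' p : barlowStacking a h s', ∑' q : barlowStacking a h s',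
        (if dist (p : EuclideanSpace ℝ (Fin 3)) q ≤ 11 / 10 * a then ‖u p - u q‖ ^ 2
          else 0) := by
    refine tsum_tsum_barlowStacking_eq_of_agree hh hag' hU
      (fun p q => if dist p q ≤ 11 / 10 * a then ‖u p - u q‖ ^ 2 else 0) ?_ ?_
    · intro p q hp hq
      rw [Function.notMem_support] at hp hq
      simp [hp, hq]
    · intro p q hpq
      have : ¬ dist p q ≤ 11 / 10 * a := not_le.2 (by linarith)
      simp [this]
  have eR : (∑' p : barlowStacking a h s, ∑' q : barlowStacking a h s,
      (if (p : EuclideanSpace ℝ (Fin 3)) ≠ q then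
        hessV ((p : EuclideanSpace ℝ (Fin 3)) - q) (u p - u q) else 0)) =
      ∑' p : barlowStacking a h s', ∑' q : barlowStacking a h s',
        (if (p : EuclideanSpace ℝ (Fin 3)) ≠ q then
          hessV ((p : EuclideanSpace ℝ (Fin 3)) - q) (u p - u q) else 0) := by
    refine tsum_tsum_barlowStacking_eq_of_agree hh hag' hU
      (fun p q => if p ≠ q then hessV (p - q) (u p - u q) else 0) ?_ ?_
    · intro p q hp hq
      rw [Function.notMem_support] at hp hq
      simp [hp, hq, F1]
    · intro p q hpq
      have h2 : 2 ≤ ‖p - q‖ := by rw [← dist_eq_norm]; linarith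
      simp [F2 _ _ h2]
  rw [eL, eR]
  exact key

/-- **N2 reduces to periodic words, for the `V_χ` kernels of the stub** (`kRad = V_χ''`,
`kTan = V_χ'/r`, written as the stub's `let`s): the kernels vanish from `2` on and the form vanishes
at `w = 0`, so `harmonicCoercivityWindow_of_periodic` applies. [folklore] -/
theorem harmonicCoercivityWindow_of_periodic_truncLJ :
    let kTan : ℝ → ℝ := fun r => if r < 3 / 2 then (-(r⁻¹) ^ 13 + (r⁻¹) ^ 7) / r else if r < 2 then (-2 * Literature.MathematicalPhysics.StatisticalMechanics.lennardJones r + (4 - 2 * r) * (-(r⁻¹) ^ 13 + (r⁻¹) ^ 7)) / r else 0; let kRad : ℝ → ℝ := fun r => if r < 3 / 2 then 13 * (r⁻¹) ^ 14 - 7 * (r⁻¹) ^ 8 else if r < 2 then -4 * (-(r⁻¹) ^ 13 + (r⁻¹) ^ 7) + (4 - 2 * r) * (13 * (r⁻¹) ^ 14 - 7 * (r⁻¹) ^ 8) else 0; let hessV : EuclideanSpace ℝ (Fin 3) → EuclideanSpace ℝ (Fin 3) → ℝ := fun e w => kRad ‖e‖ * (inner ℝ e w / ‖e‖) ^ 2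 + kTan ‖e‖ * (‖w‖ ^ 2 - (inner ℝ e w / ‖e‖) ^ 2);
    ∀ κ : ℝ, (∀ (s : ℤ → ℤ) (p : ℕ), p ≠ 0 → (∀ i : ℤ, s (i + p) = s i) → Literature.MathematicalPhysics.StatisticalMechanics.IsHaggSeq s → ∀ a h : ℝ, 93 / 100 ≤ a → a ≤ 51 / 50 → 78 / 100 * a ≤ h → h ≤ 86 / 100 * a → ∀ u : EuclideanSpace ℝ (Fin 3) → EuclideanSpace ℝ (Fin 3), (Function.support u).Finite → Function.support u ⊆ Literature.MathematicalPhysics.StatisticalMechanics.barlowStacking a h s → κ * (∑' p : Literature.MathematicalPhysics.StatisticalMechanics.barlowStacking a h s, ∑' q : Literature.MathematicalPhysics.StatisticalMechanics.barlowStacking a h s, if dist (p : EuclideanSpace ℝ (Fin 3)) q ≤ 11 / 10 * a then ‖u p - u q‖ ^ 2 else 0) ≤ (∑' p : Literature.MathematicalPhysics.StatisticalMechanics.barlowStacking a h s, ∑' q : Literature.MathematicalPhysics.StatisticalMechanics.barlowStacking a h s, if (p : EuclideanSpace ℝ (Fin 3)) ≠ q then hessV ((p : EuclideanSpace ℝ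 (Fin 3)) - q) (u p - u q) else 0) / 2) →
    ∀ s : ℤ → ℤ, Literature.MathematicalPhysics.StatisticalMechanics.IsHaggSeq s → ∀ a h : ℝ, 93 / 100 ≤ a → a ≤ 51 / 50 → 78 / 100 * a ≤ h → h ≤ 86 / 100 * a → ∀ u : EuclideanSpace ℝ (Fin 3) → EuclideanSpace ℝ (Fin 3), (Function.support u).Finite → Function.support u ⊆ Literature.MathematicalPhysics.StatisticalMechanics.barlowStacking a h s → κ * (∑' p : Literature.MathematicalPhysics.StatisticalMechanics.barlowStacking a h s, ∑' q : Literature.MathematicalPhysics.StatisticalMechanics.barlowStacking a h s, if dist (p : EuclideanSpace ℝ (Fin 3)) q ≤ 11 / 10 * a then ‖u p - u q‖ ^ 2 else 0) ≤ (∑' p : Literature.MathematicalPhysics.StatisticalMechanics.barlowStacking a h s, ∑' q : Literature.MathematicalPhysics.StatisticalMechanics.barlowStacking a h s, if (p : EuclideanSpace ℝ (Fin 3)) ≠ q then hessV ((p : EuclideanSpace ℝ (Fin 3)) - q) (u p - u q) else 0) / 2 := by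
  intro kTan kRad hessV κ hper
  -- the two structural properties of the concrete kernel
  have F1 : ∀ e : EuclideanSpace ℝ (Fin 3), hessV e 0 = 0 := by
    intro e
    simp [hessV]
  have F2 : ∀ e w : EuclideanSpace ℝ (Fin 3), 2 ≤ ‖e‖ → hessV e w = 0 := by
    intro e w he
    have h1 : ¬ ‖e‖ < 3 / 2 := not_lt.2 (by linarith)
    have h2 : ¬ ‖e‖ < 2 := not_lt.2 he
    simp [hessV, kRad, kTan, h1, h2]
  exact harmonicCoercivityWindow_of_periodic hessV F1 F2 κ hper

/-- **N2 reduces to periodic words** (existential form, literally the shape of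
`stub_harmonicCoercivityWindow`): a positive constant that works for all periodic Hägg words works
for all Hägg words. [folklore] -/
theorem harmonicCoercivityWindow_of_periodic_truncLJ' :
    let kTan : ℝ → ℝ := fun r => if r < 3 / 2 then (-(r⁻¹) ^ 13 + (r⁻¹) ^ 7) / r else if r < 2 then (-2 * Literature.MathematicalPhysics.StatisticalMechanics.lennardJones r + (4 - 2 * r) * (-(r⁻¹) ^ 13 + (r⁻¹) ^ 7)) / r else 0; let kRad : ℝ → ℝ := fun r => if r < 3 / 2 then 13 * (r⁻¹) ^ 14 - 7 * (r⁻¹) ^ 8 else if r < 2 then -4 * (-(r⁻¹) ^ 13 + (r⁻¹) ^ 7) + (4 - 2 * r) * (13 * (r⁻¹) ^ 14 - 7 * (r⁻¹) ^ 8) else 0; let hessV : EuclideanSpace ℝ (Fin 3) → EuclideanSpace ℝ (Fin 3) → ℝ := fun e w => kRad ‖e‖ * (inner ℝ e w / ‖e‖) ^ 2 + kTan ‖e‖ * (‖w‖ ^ 2 - (inner ℝ e w / ‖e‖) ^ 2);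
    (∃ κ : ℝ, 0 < κ ∧ ∀ (s : ℤ → ℤ) (p : ℕ), p ≠ 0 → (∀ i : ℤ, s (i + p) = s i) → Literature.MathematicalPhysics.StatisticalMechanics.IsHaggSeq s → ∀ a h : ℝ, 93 / 100 ≤ a → a ≤ 51 / 50 → 78 / 100 * a ≤ h → h ≤ 86 / 100 * a → ∀ u : EuclideanSpace ℝ (Fin 3) → EuclideanSpace ℝ (Fin 3), (Function.support u).Finite → Function.support u ⊆ Literature.MathematicalPhysics.StatisticalMechanics.barlowStacking a h s → κ * (∑' p : Literature.MathematicalPhysics.StatisticalMechanics.barlowStacking a h s, ∑' q : Literature.MathematicalPhysics.StatisticalMechanics.barlowStacking a h s, if dist (p : EuclideanSpace ℝ (Fin 3)) q ≤ 11 / 10 * a then ‖u p - u q‖ ^ 2 else 0) ≤ (∑' p : Literature.MathematicalPhysics.StatisticalMechanics.barlowStacking a h s, ∑' q : Literature.MathematicalPhysics.StatisticalMechanics.barlowStacking a h s, if (p : EuclideanSpace ℝ (Fin 3)) ≠ q then hessV ((p : EuclideanSpace ℝ (Fin 3)) - q) (u p - u q) else 0) / 2) →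
    ∃ κ : ℝ, 0 < κ ∧ ∀ s : ℤ → ℤ, Literature.MathematicalPhysics.StatisticalMechanics.IsHaggSeq s → ∀ a h : ℝ, 93 / 100 ≤ a → a ≤ 51 / 50 → 78 / 100 * a ≤ h → h ≤ 86 / 100 * a → ∀ u : EuclideanSpace ℝ (Fin 3) → EuclideanSpace ℝ (Fin 3), (Function.support u).Finite → Function.support u ⊆ Literature.MathematicalPhysics.StatisticalMechanics.barlowStacking a h s → κ * (∑' p : Literature.MathematicalPhysics.StatisticalMechanics.barlowStacking a h s, ∑' q : Literature.MathematicalPhysics.StatisticalMechanics.barlowStacking a h s, if dist (p : EuclideanSpace ℝ (Fin 3)) q ≤ 11 / 10 * a then ‖u p - u q‖ ^ 2 else 0) ≤ (∑' p : Literature.MathematicalPhysics.StatisticalMechanics.barlowStacking a h s, ∑' q : Literature.MathematicalPhysics.StatisticalMechanics.barlowStacking a h s, if (p : EuclideanSpace ℝ (Fin 3)) ≠ q then hessV ((p : EuclideanSpace ℝ (Fin 3)) - q) (u p - u q) else 0) / 2 := by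
  intro kTan kRad hessV hyp
  obtain ⟨κ, hκ, hper⟩ := hyp
  exact ⟨κ, hκ, harmonicCoercivityWindow_of_periodic_truncLJ κ hper⟩

end Summit.AtomisticToContinuum.Crystallization.Theorems.PricedLinkCensusTruncatedCensusGap

end
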